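import Summits.QuantumFields.YangMills.Theorems.TwistExponentGapCentralLadder
import Literature.MathematicalPhysics.QuantumFieldTheory.ConstructiveQFTWave0
import HarnessLib

/-!
# Pair-rigidity ⇒ the gauge stabiliser of a twisted-flat lattice configuration is finite (step (W1) of ⟨stmt-QuantumFields-24054⟩)
# (route-independent helper toward the crux `TwistExponentGap.RigidTwistCeiling`; free hands of width seat ym-line-sfw-p2-w3)

With `TwistExponentGapCovConstOfFiniteStabilizer` (finite stabiliser ⇒ `h⁰ = 0`) and `TwistExponentGapLatticeCocycle` (`h⁰ = 0 ⇒
h¹ = 0`) this closes the GROUP/LINEAR side of the remaining local Morse–Bott inequality of the crux: what is left after this file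
is (W2) the instantiation with `Ad` on `𝔤_ρ` and (W3) the exponential-chart tangent calculus (XL).

`finite_stabilizer_of_twistedFlat`: on the discrete torus `(ℤ/S)^d` let `U₀` be `z`-twisted flat in the plane `q = (μ, ν)`
(`z_x · U₀,□(x;μ,ν) = 1` with `z_x = z` iff `x_μ = x_ν = 0`, `z` central), and suppose every pair with commutator `z` has finite
centraliser.  Then `{g | gaugeTransform g U₀ = U₀}` is finite.  Proof: (i) a stabiliser is covariantly constant, so it commutes
with the line holonomies through `0` (`stab_mul_lineHol`) and is determined by its value at `0` (`stab_eq_of_apply_zero_eq`, all of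
`(ℤ/S)^d` is reached by shifts); (ii) non-abelian Stokes on the `μν`-slice through `0` with central plaquettes (`prod_ladder` +
`prod_column` of `TwistExponentGapCentralLadder`): row holonomy `a` and column holonomy `b` satisfy `a b = z⁻¹ b a`, the single
twisted plaquette of the slice contributing `z⁻¹`; so `(b, a)` has commutator `z`, its centraliser is finite, and `g ↦ g 0` injects
the stabiliser into it.
HONEST FRAMING: group theory on a finite lattice; nothing here bears on a summit statement or on the Yang–Mills mass gap.
-/

set_option autoImplicit false

open Literature.MathematicalPhysics.QuantumFieldTheory

namespace Summit.QuantumFields.YangMills.Theorems.TwistExponentGap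

variable {G : Type*} [Group G] {d S : ℕ}

/-! ## §1 Lattice bookkeeping -/

/-- Shifting `y + i·e_κ` in direction `κ` gives `y + (i+1)·e_κ`. -/
theorem add_single_shift (y : Site d S) (κ : Fin d) (i : ℕ) :
    (y + Pi.single κ ((i : ℕ) : ZMod S)).shift κ = y + Pi.single κ (((i + 1 : ℕ) : ℕ) : ZMod S) := by
  simp only [Site.shift, Nat.cast_add, Nat.cast_one, Pi.single_add, add_assoc]

/-- Shifting `i·e_κ` in direction `κ` gives `(i+1)·e_κ`. -/
theorem single_shift_self (κ : Fin d) (i : ℕ) :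
    Site.shift (d := d) (L := S) (Pi.single κ ((i : ℕ) : ZMod S)) κ = Pi.single κ (((i + 1 : ℕ) : ℕ) : ZMod S) := by
  simp only [Site.shift, Nat.cast_add, Nat.cast_one, Pi.single_add]

/-- Shifting `y + i·e_κ` in another direction `ℓ` gives `(y + e_ℓ) + i·e_κ`. -/
theorem add_single_shift_other (y : Site d S) (κ ℓ : Fin d) (i : ℕ) :
    (y + Pi.single κ ((i : ℕ) : ZMod S)).shift ℓ = y.shift ℓ + Pi.single κ ((i : ℕ) : ZMod S) := by
  simp only [Site.shift, add_right_comm]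

/-- Going once around: `y + S·e_κ = y`. -/
theorem add_single_self (y : Site d S) (κ : Fin d) : y + Pi.single κ (((S : ℕ) : ℕ) : ZMod S) = y := by
  simp

/-! ## §2 Stabilisers: transport, commutation with line holonomies, determination by one value -/

/-- A stabiliser is covariantly constant: `g(x)·U₀(x,κ) = U₀(x,κ)·g(x+e_κ)`. -/
theorem stab_transport {U₀ : GaugeConfig d S G} {g : Site d S → G} (hg : gaugeTransform g U₀ = U₀) (x : Site d S) (κ : Fin d) :
    g x * U₀ (x, κ) = U₀ (x, κ) * g (x.shift κ) := by
  have h := congrFun hg (x, κ)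
  simp only [gaugeTransform] at h
  calc g x * U₀ (x, κ) = g x * U₀ (x, κ) * (g (x.shift κ))⁻¹ * g (x.shift κ) := by group
    _ = U₀ (x, κ) * g (x.shift κ) := by rw [h]

/-- A stabiliser commutes past a line holonomy: `g(y)·(U₀(y,κ)⋯U₀(y+(n−1)e_κ,κ)) = (⋯)·g(y + n e_κ)`. -/
theorem stab_mul_lineHol {U₀ : GaugeConfig d S G} {g : Site d S → G} (hg : gaugeTransform g U₀ = U₀) (y : Site d S)
    (κ : Fin d) (n : ℕ) :
    g y * ((List.range n).map fun i => U₀ (y + Pi.single κ ((i : ℕ) : ZMod S), κ)).prod =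
      ((List.range n).map fun i => U₀ (y + Pi.single κ ((i : ℕ) : ZMod S), κ)).prod *
        g (y + Pi.single κ ((n : ℕ) : ZMod S)) := by
  induction n with
  | zero => simp
  | succ n ih =>
    rw [List.range_succ, List.map_append, List.map_singleton, List.prod_append, List.prod_singleton, ← mul_assoc, ih,
      mul_assoc, stab_transport hg, add_single_shift, ← mul_assoc]

/-- Two stabilisers that agree at `x` agree at `x + n·e_κ`. -/
theorem stab_eq_add_single {U₀ : GaugeConfig d S G} {g g' : Site d S → G} (hg : gaugeTransform g U₀ = U₀)
    (hg' : gaugeTransform g' U₀ = U₀) {x : Site d S} (hx : g x = g' x) (κ : Fin d) (n : ℕ) :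
    g (x + Pi.single κ ((n : ℕ) : ZMod S)) = g' (x + Pi.single κ ((n : ℕ) : ZMod S)) := by
  induction n with
  | zero => simpa using hx
  | succ n ih =>
    have h1 := stab_transport hg (x + Pi.single κ ((n : ℕ) : ZMod S)) κ
    have h2 := stab_transport hg' (x + Pi.single κ ((n : ℕ) : ZMod S)) κ
    rw [add_single_shift] at h1 h2
    rw [ih] at h1
    have h3 : U₀ (x + Pi.single κ ((n : ℕ) : ZMod S), κ) * g (x + Pi.single κ (((n + 1 : ℕ) : ℕ) : ZMod S)) =
        U₀ (x + Pi.single κ ((n : ℕ) : ZMod S), κ) * g' (x + Pi.single κ (((n + 1 : ℕ) : ℕ) : ZMod S)) := by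
      rw [← h1, ← h2]
    exact mul_left_cancel h3

/-- **A stabiliser is determined by its value at `0`** (every site of `(ℤ/S)^d` is reached from `0` by shifts). -/
theorem stab_eq_of_apply_zero_eq [NeZero S] {U₀ : GaugeConfig d S G} {g g' : Site d S → G}
    (hg : gaugeTransform g U₀ = U₀) (hg' : gaugeTransform g' U₀ = U₀) (h0 : g 0 = g' 0) : g = g' := by
  classical
  -- induction over the set of coordinates allowed to be non-zero
  have key : ∀ (T : Finset (Fin d)) (x : Site d S),
      g (∑ κ ∈ T, (Pi.single κ (x κ) : Site d S)) = g' (∑ κ ∈ T, (Pi.single κ (x κ) : Site d S)) := by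
    intro T
    induction T using Finset.induction_on with
    | empty => intro x; simpa using h0
    | insert κ T hκ ih =>
      intro x
      rw [Finset.sum_insert hκ, add_comm]
      have hval : (Pi.single κ (x κ) : Site d S) = Pi.single κ ((((x κ).val : ℕ) : ℕ) : ZMod S) := by
        rw [ZMod.natCast_zmod_val]
      rw [hval]
      exact stab_eq_add_single hg hg' (ih x) κ (x κ).val
  funext x
  have hx : x = ∑ κ ∈ (Finset.univ : Finset (Fin d)), (Pi.single κ (x κ) : Site d S) := (Finset.univ_sum_single x).symm
  rw [hx]
  exact key Finset.univ x

/-! ## §3 Non-abelian Stokes on the twisted slice and the finiteness of the stabiliser -/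

/-- **Pair-rigidity ⇒ finite gauge stabiliser of a twisted-flat configuration.**  On `(ℤ/S)^d` (`S ≥ 1`) let `U₀` satisfy
`z_x · U₀,□(x; μ, ν) = 1` in the plane `q = (μ, ν)` with `z_x = z` iff `x_μ = 0 ∧ x_ν = 0` (`z` central), and let every pair
`(x, y)` in `G` with `x y x⁻¹ y⁻¹ = z` have finite centraliser.  Then the set of lattice gauge transformations fixing `U₀` is finite. -/
theorem finite_stabilizer_of_twistedFlat [NeZero S] (U₀ : GaugeConfig d S G) (q : {p : Fin d × Fin d // p.1 < p.2}) (z : G)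
    (hz : z ∈ Subgroup.center G)
    (hrig : ∀ x y : G, x * y * x⁻¹ * y⁻¹ = z → Set.Finite {k : G | k * x = x * k ∧ k * y = y * k})
    (htf : ∀ x : Site d S, (if x q.1.1 = 0 ∧ x q.1.2 = 0 then z else 1) * plaquetteHolonomy U₀ x q.1.1 q.1.2 = 1) :
    Set.Finite {g : Site d S → G | gaugeTransform g U₀ = U₀} := by
  classical
  obtain ⟨⟨μ, ν⟩, hlt⟩ := q
  simp only at htf
  have hμν : μ ≠ ν := ne_of_lt hlt
  have hS : 1 ≤ S := Nat.one_le_iff_ne_zero.2 (NeZero.ne S)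
  -- sites of the slice through `0`: `pt j i = j·e_ν + i·e_μ`
  set pt : ℕ → ℕ → Site d S := fun j i =>
    (Pi.single ν ((j : ℕ) : ZMod S) : Site d S) + Pi.single μ ((i : ℕ) : ZMod S) with hpt
  have hs1 : ∀ j i : ℕ, (pt j i).shift μ = pt j (i + 1) := fun j i => by
    simp only [hpt]; exact add_single_shift _ μ i
  have hs2 : ∀ j i : ℕ, (pt j i).shift ν = pt (j + 1) i := fun j i => by
    simp only [hpt]; rw [add_single_shift_other, single_shift_self]
  have hcμ : ∀ j i : ℕ, pt j i μ = ((i : ℕ) : ZMod S) := fun j i => by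
    simp only [hpt, Pi.add_apply, Pi.single_eq_same, Pi.single_eq_of_ne hμν, zero_add]
  have hcν : ∀ j i : ℕ, pt j i ν = ((j : ℕ) : ZMod S) := fun j i => by
    simp only [hpt, Pi.add_apply, Pi.single_eq_same, Pi.single_eq_of_ne hμν.symm, add_zero]
  have hptS : ∀ j : ℕ, pt j S = pt j 0 := fun j => by simp only [hpt, ZMod.natCast_self, Nat.cast_zero]
  have hptS' : ∀ i : ℕ, pt S i = pt 0 i := fun i => by simp only [hpt, ZMod.natCast_self, Nat.cast_zero]
  have hpt0 : ∀ i : ℕ, pt 0 i = (0 : Site d S) + Pi.single μ ((i : ℕ) : ZMod S) := fun i => by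
    simp only [hpt, Nat.cast_zero, Pi.single_zero]
  have hpt0' : ∀ j : ℕ, pt j 0 = (0 : Site d S) + Pi.single ν ((j : ℕ) : ZMod S) := fun j => by
    simp only [hpt, Nat.cast_zero, Pi.single_zero, add_zero, zero_add]
  -- plaquette values on the slice: central; `z⁻¹` at the corner, `1` elsewhere
  have hP : ∀ j i : ℕ, plaquetteHolonomy U₀ (pt j i) μ ν = (if pt j i μ = 0 ∧ pt j i ν = 0 then z else 1)⁻¹ :=
    fun j i => eq_inv_of_mul_eq_one_right (htf (pt j i))
  have hPc : ∀ j i : ℕ, plaquetteHolonomy U₀ (pt j i) μ ν ∈ Subgroup.center G := by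
    intro j i
    rw [hP]
    split_ifs
    · exact inv_mem hz
    · rw [inv_one]; exact one_mem _
  have hPval : ∀ j i : ℕ, j < S → i < S →
      plaquetteHolonomy U₀ (pt j i) μ ν = if i = 0 ∧ j = 0 then z⁻¹ else 1 := by
    intro j i hj hi
    have e1 : (((i : ℕ) : ZMod S) = 0) ↔ i = 0 := by
      rw [ZMod.natCast_eq_zero_iff]
      exact ⟨fun h => Nat.eq_zero_of_dvd_of_lt h hi, fun h => h ▸ dvd_zero S⟩
    have e2 : (((j : ℕ) : ZMod S) = 0) ↔ j = 0 := by
      rw [ZMod.natCast_eq_zero_iff]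
      exact ⟨fun h => Nat.eq_zero_of_dvd_of_lt h hj, fun h => h ▸ dvd_zero S⟩
    simp only [hP, hcμ, hcν, e1, e2]
    split_ifs <;> simp
  -- row holonomies `R j`, vertical links `w j`, plaquette products `c j`
  set R : ℕ → G := fun j => ((List.range S).map fun i => U₀ (pt j i, μ)).prod with hR
  set w : ℕ → G := fun j => U₀ (pt j 0, ν) with hw
  set c : ℕ → G := fun j => ((List.range S).map fun i => plaquetteHolonomy U₀ (pt j i) μ ν).prod with hc
  have hcC : ∀ j, c j ∈ Subgroup.center G := fun j => by
    simp only [hc]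
    apply Subgroup.list_prod_mem
    intro g hg
    rw [List.mem_map] at hg
    obtain ⟨i, -, rfl⟩ := hg
    exact hPc j i
  -- LADDER: `R j · w j = c j · w j · R (j+1)`
  have hladder : ∀ j : ℕ, R j * w j = c j * w j * R (j + 1) := by
    intro j
    have hrel : ∀ i : ℕ, U₀ (pt j i, μ) * U₀ (pt j (i + 1), ν) =
        plaquetteHolonomy U₀ (pt j i) μ ν * U₀ (pt j i, ν) * U₀ (pt (j + 1) i, μ) := by
      intro i
      simp only [plaquetteHolonomy, hs1, hs2]
      group
    have h := prod_ladder (fun i => U₀ (pt j i, μ)) (fun i => U₀ (pt (j + 1) i, μ)) (fun i => U₀ (pt j i, ν))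
      (fun i => plaquetteHolonomy U₀ (pt j i) μ ν) (hPc j) hrel S
    simp only [hptS] at h
    simpa only [hR, hw, hc] using h
  -- COLUMN: `R 0 · B = (∏ c) · B · R S`
  have hcol := prod_column R w c hcC hladder S
  have hRS : R S = R 0 := by simp only [hR, hptS']
  -- the total plaquette product is `z⁻¹`
  have hcval : ∀ j, j < S → c j = if j = 0 then z⁻¹ else 1 := by
    intro j hj
    simp only [hc]
    by_cases hj0 : j = 0
    · subst hj0
      rw [if_pos rfl]
      have hmap : ((List.range S).map fun i => plaquetteHolonomy U₀ (pt 0 i) μ ν) =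
          (List.range S).map fun i => if i = 0 then z⁻¹ else 1 := by
        apply List.map_congr_left
        intro i hi
        rw [hPval 0 i hS (List.mem_range.1 hi)]
        simp
      rw [hmap, prod_map_ite_zero _ hS]
    · rw [if_neg hj0]
      apply prod_map_eq_one
      intro i hi
      rw [hPval j i hj hi]
      simp [hj0]
  have hctot : ((List.range S).map c).prod = z⁻¹ := by
    have hmap : (List.range S).map c = (List.range S).map fun j => if j = 0 then z⁻¹ else 1 := by
      apply List.map_congr_left
      intro j hj
      exact hcval j (List.mem_range.1 hj)
    rw [hmap, prod_map_ite_zero _ hS]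
  -- the two holonomies `a` (row through 0) and `b` (column through 0); `a b = z⁻¹ b a`
  have hab : R 0 * ((List.range S).map w).prod = z⁻¹ * (((List.range S).map w).prod * R 0) := by
    rw [hcol, hRS, hctot, mul_assoc]
  have hcomm : ((List.range S).map w).prod * R 0 * (((List.range S).map w).prod)⁻¹ * (R 0)⁻¹ = z :=
    comm_eq_of_mul_eq hab
  have hcent := hrig _ _ hcomm
  -- every stabiliser's value at `0` centralises both holonomies
  have hrow : ((List.range S).map fun i => U₀ ((0 : Site d S) + Pi.single μ ((i : ℕ) : ZMod S), μ)).prod = R 0 := by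
    simp only [hR, hpt0]
  have hcolw : ((List.range S).map fun i => U₀ ((0 : Site d S) + Pi.single ν ((i : ℕ) : ZMod S), ν)).prod =
      ((List.range S).map w).prod := by
    simp only [hw, hpt0']
  have hval0 : ∀ g : Site d S → G, gaugeTransform g U₀ = U₀ →
      g 0 * ((List.range S).map w).prod = ((List.range S).map w).prod * g 0 ∧ g 0 * R 0 = R 0 * g 0 := by
    intro g hg
    constructor
    · have h := stab_mul_lineHol hg 0 ν S
      rw [add_single_self (0 : Site d S) ν, hcolw] at h
      exact h
    · have h := stab_mul_lineHol hg 0 μ S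
      rw [add_single_self (0 : Site d S) μ, hrow] at h
      exact h
  -- `g ↦ g 0` injects the stabiliser into the finite centraliser
  refine Set.Finite.of_finite_image (f := fun g : Site d S → G => g 0) ?_ ?_
  · refine hcent.subset ?_
    rintro _ ⟨g, hg, rfl⟩
    exact hval0 g hg
  · intro g hg g' hg' hgg'
    exact stab_eq_of_apply_zero_eq hg hg' hgg'

end Summit.QuantumFields.YangMills.Theorems.TwistExponentGap
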